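import Mathlib.Data.Real.Basic
import Mathlib.Tactic.Linarith
import Mathlib.Tactic.Positivity
import Mathlib.Tactic.FieldSimp
import Mathlib.Tactic.Ring
import HarnessLib

/-!
# Scalar cores of three reductions used by the pub-turb shear certificates (cell `turb-bounds`, seat pub-turb-shear)

HONEST FRAMING: rigorous bounds for the stated PDE and boundary conditions; no claim about physical
turbulence beyond the bound. This file formalises ONLY the elementary real-number inequalities at the
core of three steps written up in `run/shared/lean/pub/pub-turb/CERT-SHEAR.md` (§3 wavevector cutoff,
§4 all-Re transfer) and `code/rbsdp/SPEC.md` §2.2 (rational relaxation of the FW16 spectral constraint).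
The function-space statements (quadratic forms over divergence-free fields) are NOT formalised here: each
lemma below is what remains after the norms `‖W″‖², ‖W′‖², ‖W‖², ‖w₁‖, ‖w₃‖, …` of a FIXED test field are
named as real numbers. No PDE theory, no Mathlib analysis beyond ordered fields.

* `allRe_transfer` — CERT-SHEAR §4: if `0 ≤ D`, `0 ≤ c`, `0 ≤ Re ≤ Re₂` and `0 ≤ c·D + Re₂·H` then
  `0 ≤ c·D + Re·H` (the spectral constraint certified at `Re₂` holds at every smaller `Re`, H being the
  sign-indefinite production term). [cite: RZG25 = arXiv:2503.04005, §2.3 eq. (spectral Re)]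
* `wavevector_cutoff` — CERT-SHEAR §3: `c·K·n² − 2·G·a·b ≥ (c·K − G)·n²` whenever `a² + b² ≤ n²`
  (`K = |𝐤|²`, `a = ‖ŵ₁‖`, `b = ‖ŵ₃‖`, `n = ‖ŵ‖`, `G ≥ ‖g‖_∞`), so every wavevector with `c·K ≥ G` is free.
* `fw16_rational_relaxation` — rbsdp SPEC 2.2: replacing `16/α², α², 8/α` by rationals `A ≤ 16/α²`,
  `C ≤ α²`, `D ≥ 8/α` is on the safe side. [cite: FW16 = arXiv:1512.05615, §4.2 (4.13)–(4.15)]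
-/

namespace Summit.NavierStokesRegularity.TurbBounds

/-- CERT-SHEAR §4 (all-Re transfer), scalar core: a constraint of the shape `c·D + Re·H ≥ 0` with a
non-negative dissipation part `D` (weight `c ≥ 0`) and a production part `H` of either sign, once it holds
at `Re₂`, holds at every `Re` with `0 ≤ Re ≤ Re₂`. -/
theorem allRe_transfer {c D H Re Re₂ : ℝ} (hc : 0 ≤ c) (hD : 0 ≤ D) (hRe : 0 ≤ Re) (hle : Re ≤ Re₂)
    (h₂ : 0 ≤ c * D + Re₂ * H) : 0 ≤ c * D + Re * H := by
  rcases le_or_gt 0 H with hH | hH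
  · have h1 : 0 ≤ c * D := mul_nonneg hc hD
    have h2 : 0 ≤ Re * H := mul_nonneg hRe hH
    linarith
  · have h3 : Re₂ * H ≤ Re * H := by nlinarith
    linarith

/-- The same transfer stated for a whole family of test fields at once: if for every field (index `i`)
the dissipation part is non-negative and the constraint holds at `Re₂`, it holds at `Re ≤ Re₂`. -/
theorem allRe_transfer_forall {ι : Type*} {c Re Re₂ : ℝ} (D H : ι → ℝ) (hc : 0 ≤ c) (hRe : 0 ≤ Re)
    (hle : Re ≤ Re₂) (hD : ∀ i, 0 ≤ D i) (h₂ : ∀ i, 0 ≤ c * D i + Re₂ * H i) :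
    ∀ i, 0 ≤ c * D i + Re * H i :=
  fun i => allRe_transfer hc (hD i) hRe hle (h₂ i)

/-- CERT-SHEAR §3 (wavevector / streamwise cutoff), scalar core: with `a = ‖ŵ₁‖`, `b = ‖ŵ₃‖`,
`n² ≥ a² + b²` (the full norm also contains `ŵ₂` and the `z`-derivatives were already dropped),
`K = |𝐤|²` and `G ≥ 0` a bound on `‖g‖_∞`, one has `c·K·n² − 2·G·a·b ≥ (c·K − G)·n²`. -/
theorem wavevector_cutoff {c K G a b n : ℝ} (hG : 0 ≤ G) (hab : a ^ 2 + b ^ 2 ≤ n ^ 2) :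
    (c * K - G) * n ^ 2 ≤ c * K * n ^ 2 - 2 * G * a * b := by
  have h2ab : 2 * a * b ≤ a ^ 2 + b ^ 2 := by nlinarith [sq_nonneg (a - b)]
  have h : 2 * G * a * b ≤ G * n ^ 2 := by nlinarith
  linarith

/-- Consequence used for the label bookkeeping: if `c·K ≥ G` then the (relaxed) constraint value
`c·K·n² − 2·G·a·b` is non-negative — the wavevector is "free" (needs no LMI). -/
theorem wavevector_free {c K G a b n : ℝ} (hG : 0 ≤ G) (hab : a ^ 2 + b ^ 2 ≤ n ^ 2)
    (hcut : G ≤ c * K) : 0 ≤ c * K * n ^ 2 - 2 * G * a * b := by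
  have h := wavevector_cutoff (c := c) (K := K) hG hab
  have hn : 0 ≤ (c * K - G) * n ^ 2 := mul_nonneg (by linarith) (sq_nonneg n)
  linarith

/-- rbsdp SPEC 2.2 (rational relaxation of FW16's spectral constraint), scalar core. For a fixed test
function put `p = ‖W″‖²`, `q = ‖W′‖²`, `r = ‖W‖²` (all `≥ 0`) and `X = ∫ φ′ Im(W′ W̄)` (any sign). If the
rational constants satisfy `A ≤ 16/α²`, `C ≤ α²`, `8/α ≤ D` and the RELAXED form is non-negative for both
signs of the indefinite term (the relaxed form is certified for the field AND for its mirror image, which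
flips the sign of `X`), then FW16's form `Q = (16/α²)p + 8q + α² r − (8/α)X` is non-negative. -/
theorem fw16_rational_relaxation {α A C D p q r X : ℝ} (hα : 0 < α) (hA : A ≤ 16 / α ^ 2)
    (hC : C ≤ α ^ 2) (hD : 8 / α ≤ D) (hp : 0 ≤ p) (hq : 0 ≤ q) (hr : 0 ≤ r)
    (hG : 0 ≤ A * p + 8 * q + C * r - D * X) :
    0 ≤ 16 / α ^ 2 * p + 8 * q + α ^ 2 * r - 8 / α * X := by
  have h8 : 0 ≤ 8 / α := by positivity
  rcases le_or_gt 0 X with hX | hX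
  · -- X ≥ 0: every replacement only lowers the relaxed form, so Q ≥ G ≥ 0
    have h1 : A * p ≤ 16 / α ^ 2 * p := mul_le_mul_of_nonneg_right hA hp
    have h2 : C * r ≤ α ^ 2 * r := mul_le_mul_of_nonneg_right hC hr
    have h3 : 8 / α * X ≤ D * X := mul_le_mul_of_nonneg_right hD hX
    linarith
  · -- X < 0: Q is a sum of non-negative terms plus the positive term -(8/α)X
    have h1 : 0 ≤ 16 / α ^ 2 * p := by positivity
    have h2 : 0 ≤ α ^ 2 * r := by positivity
    have h3 : 0 ≤ -(8 / α * X) := by nlinarith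
    linarith

end Summit.NavierStokesRegularity.TurbBounds
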